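import Summits.BirchSwinnertonDyer.Rank1Residual.X11b.LocalTrivialityBridge
import Literature.NumberTheory.GaloisRepresentations.ContinuousShapiroLiftMackeyH1Equiv
import Literature.NumberTheory.GaloisRepresentations.ContinuousShapiroLiftMackeyH1
import Literature.NumberTheory.GaloisRepresentations.ContinuousShapiroLiftVanishing
import Literature.NumberTheory.GaloisRepresentations.CoinducedDiscreteGaloisModule
import Literature.NumberTheory.EllipticCurves.GreenbergVatsal2000.GreenbergSelmerGroups
import Literature.NumberTheory.EllipticCurves.KummerSelmerStructure
import Literature.NumberTheory.GaloisRepresentations.UnramifiedClassesInertia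
import HarnessLib

/-!
# Crux `PrintCf2.SplitBadTwoRankOneOfFacts` (stmt-BirchSwinnertonDyer-20368), skeleton v13.1, stub S3n′ `stub_pseudoNullFinite_two`,
# S3N-FACTFREE brick R2, file 2 (B2a of `Cruxes/…/R2-BRICKS-w5g7.md`): THE SHAPIRO LIFT OF A LAYER CLASS IS UNRAMIFIED AT `w`
# IFF EVERY CONJUGATE OF THE CLASS IS UNRAMIFIED AT THE PLACE OF THE LAYER ABOVE `w` — the local condition «unramified» read
# through Shapiro's lemma, in the LINE's currency (`subgroupH1 U M`, `conjH1`, `GreenbergVatsal2000.unramifiedKer`)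

Cell `bsd-print-cf2`, WIDTH seat `bsd-line-cf2-p1-w5` g7 (prover-bsd-line-cf2-p1-w5-g7-0); `--supports stmt-BirchSwinnertonDyer-20368`
(helper, Theses-free). HONEST FRAMING: nothing here closes the crux or a registered stub; BSD is not proved by any of this; no summit
statement is proved by this seat. No definition, no named fact, no `sorry`. Unconditional.

SETTING. `K` a number field, `M` a discrete `Γ_K`-module with open stabilisers (`hM`; `ofSMul M hM` its `DiscreteGaloisModule` avatar,
X11b `LocBridge`, `toTopRep = discreteTopRep Γ_K M` by `rfl`), `U ⊴ Γ_K` OPEN of finite index (a layer `layerSubgroup κ n` of a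
`ℤ_p`-extension, say; `F = K̄^U`), `s` representatives of `Γ_K ⧸ U` with `s(1) = 1` (they exist: `exists_reps_one`), `w` a finite place of
`K` with the tree's decomposition / inertia groups `D_w = decomp w = range θ_w`, `I_w = inertia w = θ_w(absInertia K_w)`,
`θ_w = absGaloisRestrict K K_w`. The Shapiro lift `Sh = shapiroLift (ofSMul M hM).toTopRep U hU hs hs1 : H¹(U, M) ⥲ H¹(Γ_K, Maps(Γ_K ⧸ U, M))`
(tree `ContinuousShapiroLiftCores`, bijective) takes the line's `subgroupH1 U M` (= `continuousCohomology 1 (subgroupRep _ U)` by `rfl`) to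
`galoisCohomology ((ofSMul M hM).coind U hU) 1` (`CoinducedDiscreteGaloisModule.toTopRep_coind`, `rfl`), where Poitou–Tate over `K` lives.

WHAT.
* §1 `mem_unramifiedKer_iff_exists` — cocycle reading of the line's unramified condition: `[φ] ∈ unramifiedKer H M v` iff `φ` is principal
  on `H ⊓ I_v` (`∃ m, ∀ x : inertiaIn H v, φ x = x • m − m`).
* §2 `localization_coind_oneCocycleClass`, **`localization_mem_unramifiedSubgroup_iff_map_inertia_eq_zero`** — for a class `x` of the
  coinduced module: `loc_w x ∈ H¹_ur(K_w, Maps(Γ_K ⧸ U, M))` (`DiscreteGaloisModule.unramifiedSubgroup (GaloisRep.toLocal w _) 1`, the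
  Selmer-structure currency of `PoitouTateSelmerStructures`) iff the pull-back of `x` along `θ_w|_{absInertia K_w} : I(K_w) → Γ_K` vanishes
  (the Mackey dialect `ContinuousCohomology.map θ (𝟙 _) 1 x = 0` of `ContinuousShapiroLiftVanishing` / `…MackeyH1`).
* §3 **`conjH1_mem_unramifiedKer_of_localization_shapiroLift_mem`** (⟹, ORBIT DETECTION `map_comapCoeffHom_conjMap_eq_zero_of_map_shapiroLift_eq_zero`
  with `D = absInertia K_w`): if `loc_w (Sh z)` is unramified then `conjH1 U M σ z ∈ unramifiedKer U M w` for EVERY `σ ∈ Γ_K` (all places of `F`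
  above `w`); **`localization_shapiroLift_mem_unramifiedSubgroup_of_forall_conjH1_mem`** (⟸, `map_shapiroLift_eq_zero_of_reps`: the conjugate
  local restrictions are principal on `I(K_w)`); packaged **`localization_shapiroLift_mem_unramifiedSubgroup_iff`**. No hypothesis on `w`
  (ramified places of `F/K`, e.g. `w = v̄` for the `v̄`-ramified line, included: the general Schreier-transversal argument of the tree handles
  several `I(K_w)`-orbits on `Γ_K ⧸ U`).
USE (R2 brick B2, memo §3): with Poitou–Tate over `K` for `Maps(Γ_K ⧸ U, M_m)` (`ProNullLift.exists_selmer_sub_localMap_mem_canonical_of_dualPullback_eq_zero`,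
p700098) and the Selmer structure «unramified at `w`», this file turns the conclusion `loc_w x ∈ 𝓕_w` at the places `w ∉ T` into the second
clause `∀ σ, conjH1 U M σ z ∈ unramifiedKer U M w` of (SUR_U) (memo §1); the first clause (targets mod unramified) is the component reading B2b.
presearch: NSW (1.6.4)–(1.6.5), Brown III (5.6)(b); the tree's continuous Shapiro/Mackey stack (bsd-wall RTT/TP2 precedent
`…LayerShapiroAwayVanishing`); no new fact. beyond-print theorem: no.

References: [NeukirchSchmidtWingberg2008] I §5 (1.5.6)–(1.5.7), I §6 (1.6.4)–(1.6.5); [Brown1982] III §5 (5.6)(b); [MilneADT2006] I §2;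
[GreenbergVatsal2000] §2 p. 17; [SerreLocalFields1979] VII §5–§6.
-/

noncomputable section

open scoped Classical

set_option linter.dupNamespace false
set_option autoImplicit false

open CategoryTheory NumberField IsDedekindDomain Field ValuativeRel
open Literature.NumberTheory.EllipticCurves Literature.NumberTheory.EllipticCurves.GreenbergSelmer
open Literature.NumberTheory.EllipticCurves.GreenbergVatsal2000
open Literature.NumberTheory.GaloisRepresentations
open Summit.BirchSwinnertonDyer.Rank1Residual.X11b.LocBridge

namespace Summit.BirchSwinnertonDyer.BirchSwinnertonDyer.Theorems.PrintCf2.LayerShapiro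

variable {K : Type} [Field K] [NumberField K]
variable {M : Type} [AddCommGroup M] [DistribMulAction (absoluteGaloisGroup K) M] [TopologicalSpace M] [DiscreteTopology M]
  (hM : ∀ m : M, IsOpen {σ : absoluteGaloisGroup K | σ • m = m})
  (U : Subgroup (absoluteGaloisGroup K)) [U.Normal] (hU : IsOpen (U : Set (absoluteGaloisGroup K)))
  [Fintype (absoluteGaloisGroup K ⧸ U)] {s : absoluteGaloisGroup K ⧸ U → absoluteGaloisGroup K}
  (hs : ∀ y, (s y : absoluteGaloisGroup K ⧸ U) = y) (hs1 : s ((1 : absoluteGaloisGroup K) : absoluteGaloisGroup K ⧸ U) = 1)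
  (w : HeightOneSpectrum (𝓞 K))

/-! ## §1. The line's unramified condition on cocycles -/

omit [U.Normal] in
/-- **`[φ] ∈ unramifiedKer H M v` iff `φ` is principal on `H ⊓ I_v`**: `∃ m, ∀ x ∈ inertiaIn H v, φ(x) = x • m − m` (the kernel of the restriction
to the inertia subgroup read on a representing cocycle; `oneCocycleClass_eq_zero_iff`). [cite: GreenbergVatsal2000, §2 p. 17] [cite: MilneADT2006, Ch. I §2] -/
theorem mem_unramifiedKer_iff_exists (H : Subgroup (absoluteGaloisGroup K)) (v : HeightOneSpectrum (𝓞 K))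
    (φ : contOneCocycles (discreteTopRep H M)) :
    oneCocycleClass _ φ ∈ GreenbergVatsal2000.unramifiedKer H M v ↔
      ∃ m : M, ∀ x : inertiaIn H v, φ.1 (inertiaInToH H v x) = ((x : decomp (K := K) v) : absoluteGaloisGroup K) • m - m := by
  have e : resH1Hom (inertiaInToH H v) (AddMonoidHom.id M) (fun _ _ ↦ rfl) (oneCocycleClass _ φ) =
      oneCocycleClass _ (contOneCocycles.pullback (inertiaInToH H v)
        (resHomOfEquivariant (inertiaInToH H v) (AddMonoidHom.id M) (fun _ _ ↦ rfl)) φ) :=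
    map_oneCocycleClass _ _ _ φ
  rw [GreenbergVatsal2000.unramifiedKer, AddMonoidHom.mem_ker, e, oneCocycleClass_eq_zero_iff]
  rfl

/-! ## §2. «Unramified at `w`» for the coinduced module: Selmer-structure currency ↔ Mackey currency -/

omit [U.Normal] in
/-- The localisation at `w` of a class of `Maps(Γ_K ⧸ U, M)` on a representing cocycle: `loc_w [F] = [F ∘ θ_w]`
(`galoisCohomology.res_one_oneCocycleClass` at `K_w`). [cite: SerreGaloisCohomology1997, I §2.4] -/
theorem localization_coind_oneCocycleClass (F : contOneCocycles ((ofSMul M hM).coind U hU).toTopRep) :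
    galoisCohomology.localization ((ofSMul M hM).coind U hU) (Sum.inr w) 1
        (oneCocycleClass ((ofSMul M hM).coind U hU).toTopRep F) =
      oneCocycleClass (DiscreteGaloisModule.toTopRep (GaloisRep.toLocal w ((ofSMul M hM).coind U hU)))
        (contOneCocycles.pullback (absGaloisRestrict K (w.adicCompletion K)) (X := ((ofSMul M hM).coind U hU).toTopRep)
          (Y := DiscreteGaloisModule.toTopRep (GaloisRep.toLocal w ((ofSMul M hM).coind U hU)))
          (TopRep.ofHom ⟨ContinuousLinearMap.id ℤ _, fun _ ↦ rfl⟩) F) :=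
  galoisCohomology.res_one_oneCocycleClass (w.adicCompletion K) F

omit [U.Normal] in
/-- **`loc_w x ∈ H¹_ur(K_w, Maps(Γ_K ⧸ U, M))` iff the pull-back of `x` along `θ_w|_{I(K_w)} : absInertia K_w → Γ_K` vanishes** — the
unramified condition of the Poitou–Tate Selmer structures (`unramifiedSubgroup`, via `oneCocycleClass_mem_unramifiedSubgroup_iff_exists`: principal
on `absInertia K_w`) in the Mackey dialect `ContinuousCohomology.map θ (𝟙 _) 1 x = 0` (`map_oneCocycleClass_eq_zero_iff`).
[cite: MilneADT2006, Ch. I §2 (unramified cohomology)] [cite: NeukirchSchmidtWingberg2008, I §5 (1.5.6)] -/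
theorem localization_mem_unramifiedSubgroup_iff_map_inertia_eq_zero (x : galoisCohomology ((ofSMul M hM).coind U hU) 1) :
    galoisCohomology.localization ((ofSMul M hM).coind U hU) (Sum.inr w) 1 x ∈
        DiscreteGaloisModule.unramifiedSubgroup (GaloisRep.toLocal w ((ofSMul M hM).coind U hU)) 1 ↔
      ContinuousCohomology.map
          ((absGaloisRestrict K (w.adicCompletion K)).comp
            (Literature.NumberTheory.GaloisRepresentations.subgroupIncl (absInertia (w.adicCompletion K))))
          (𝟙 (TopRep.res
            (((absGaloisRestrict K (w.adicCompletion K)).comp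
              (Literature.NumberTheory.GaloisRepresentations.subgroupIncl (absInertia (w.adicCompletion K))) :
                ↥(absInertia (w.adicCompletion K)) →ₜ* absoluteGaloisGroup K) :
                ↥(absInertia (w.adicCompletion K)) →* absoluteGaloisGroup K)
            (coindFin (ofSMul M hM).toTopRep U))) 1 x = 0 := by
  obtain ⟨F, rfl⟩ := oneCocycleClass_surjective ((ofSMul M hM).coind U hU).toTopRep x
  rw [localization_coind_oneCocycleClass]
  refine (DiscreteGaloisModule.oneCocycleClass_mem_unramifiedSubgroup_iff_exists
    (GaloisRep.toLocal w ((ofSMul M hM).coind U hU)) _).trans ?_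
  have e := map_oneCocycleClass_eq_zero_iff (coindFin (ofSMul M hM).toTopRep U) _
    ((absGaloisRestrict K (w.adicCompletion K)).comp
      (Literature.NumberTheory.GaloisRepresentations.subgroupIncl (absInertia (w.adicCompletion K))))
    (𝟙 _) Function.bijective_id F
  refine Iff.trans ?_ e.symm
  constructor
  · rintro ⟨Φ, hΦ⟩
    exact ⟨Φ, fun l ↦ hΦ l l.2⟩
  · rintro ⟨Φ, hΦ⟩
    exact ⟨Φ, fun τ hτ ↦ hΦ ⟨τ, hτ⟩⟩


/-! ## §3. The Shapiro lift is unramified at `w` iff every conjugate of the layer class is -/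

/-- **(⟹) ORBIT DETECTION ON INERTIA.** If the localisation at `w` of the Shapiro lift `Sh z` of `z ∈ H¹(U, M)` is unramified, then for EVERY
`σ ∈ Γ_K` the conjugate `conjH1 U M σ z` restricts to zero on `U ⊓ I_w` (`∈ unramifiedKer U M w`): the tree's
`map_comapCoeffHom_conjMap_eq_zero_of_map_shapiroLift_eq_zero` with `D = absInertia K_w → Γ_K`, then `U ⊓ I_w ⊓ D_w` is covered by
`θ_w(absInertia K_w) ∩ U` (`inertia w = (absInertia K_w).map θ_w`), so a cocycle principal on the pull-back is principal on `inertiaIn U w`.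
[cite: NeukirchSchmidtWingberg2008, I §6 Prop. (1.6.4)–(1.6.5)] [cite: Brown1982, III §5 (5.6)(b)] -/
theorem conjH1_mem_unramifiedKer_of_localization_shapiroLift_mem (z : subgroupH1 U M)
    (h : galoisCohomology.localization ((ofSMul M hM).coind U hU) (Sum.inr w) 1
        (shapiroLift (ofSMul M hM).toTopRep U hU hs hs1 z) ∈
      DiscreteGaloisModule.unramifiedSubgroup (GaloisRep.toLocal w ((ofSMul M hM).coind U hU)) 1)
    (σ : absoluteGaloisGroup K) : conjH1 U M σ z ∈ GreenbergVatsal2000.unramifiedKer U M w := by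
  have h0 := (localization_mem_unramifiedSubgroup_iff_map_inertia_eq_zero hM U hU w _).1 h
  obtain ⟨sD, hsD, hsD1⟩ := exists_reps_one
    (N := U.comap (((absGaloisRestrict K (w.adicCompletion K)).comp
      (Literature.NumberTheory.GaloisRepresentations.subgroupIncl (absInertia (w.adicCompletion K))) :
        ↥(absInertia (w.adicCompletion K)) →ₜ* absoluteGaloisGroup K) : ↥(absInertia (w.adicCompletion K)) →* absoluteGaloisGroup K))
  obtain ⟨f, rfl⟩ := oneCocycleClass_surjective (subgroupRep (ofSMul M hM).toTopRep U) z
  have hdet := map_comapCoeffHom_conjMap_eq_zero_of_map_shapiroLift_eq_zero (ofSMul M hM).toTopRep U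
    ((absGaloisRestrict K (w.adicCompletion K)).comp
      (Literature.NumberTheory.GaloisRepresentations.subgroupIncl (absInertia (w.adicCompletion K))))
    hU hs hs1 hsD hsD1 (oneCocycleClass _ f) h0 σ
  rw [conjMap_oneCocycleClass, map_oneCocycleClass_eq_zero_iff _ _ _ _ Function.bijective_id] at hdet
  obtain ⟨v, hv⟩ := hdet
  change (conjMap (ofSMul M hM).toTopRep U σ 1).hom (oneCocycleClass _ f) ∈ GreenbergVatsal2000.unramifiedKer U M w
  rw [conjMap_oneCocycleClass]
  refine (mem_unramifiedKer_iff_exists (M := M) U w _).2 ⟨v, fun x ↦ ?_⟩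
  have hxI : ((x : decomp (K := K) w) : absoluteGaloisGroup K) ∈ inertia w := ((mem_inertiaIn_iff U w _).1 x.2).2
  have hxU : ((x : decomp (K := K) w) : absoluteGaloisGroup K) ∈ U := ((mem_inertiaIn_iff U w _).1 x.2).1
  obtain ⟨τ, hτ, hτx⟩ := Subgroup.mem_map.1 hxI
  have hd : (⟨τ, hτ⟩ : ↥(absInertia (w.adicCompletion K))) ∈
      U.comap (((absGaloisRestrict K (w.adicCompletion K)).comp
        (Literature.NumberTheory.GaloisRepresentations.subgroupIncl (absInertia (w.adicCompletion K))) :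
          ↥(absInertia (w.adicCompletion K)) →ₜ* absoluteGaloisGroup K) :
          ↥(absInertia (w.adicCompletion K)) →* absoluteGaloisGroup K) := by
    rw [Subgroup.mem_comap]
    change absGaloisRestrict K (w.adicCompletion K) τ ∈ U
    rw [show absGaloisRestrict K (w.adicCompletion K) τ = _ from hτx]
    exact hxU
  have hx : inertiaInToH U w x =
      comapSubtypeHom U ((absGaloisRestrict K (w.adicCompletion K)).comp
        (Literature.NumberTheory.GaloisRepresentations.subgroupIncl (absInertia (w.adicCompletion K)))) ⟨⟨τ, hτ⟩, hd⟩ := by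
    apply Subtype.ext
    rw [comapSubtypeHom_apply_coe]
    exact hτx.symm
  rw [hx, hv]
  change (absGaloisRestrict K (w.adicCompletion K) τ) • v - v = _
  rw [show absGaloisRestrict K (w.adicCompletion K) τ = _ from hτx]

/-- **(⟸) VANISHING ON INERTIA FROM THE CONJUGATES.** If every conjugate `conjH1 U M σ z` is unramified at `w`, then `loc_w (Sh z)` is
unramified: the tree's `map_shapiroLift_eq_zero_of_reps` (a restricted Shapiro lift is a coboundary when every conjugate local restriction of the
cocycle is principal) with `D = absInertia K_w`; the hypothesis at the representative `s y₀` is the principal vector of `conj_{s y₀} z` on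
`U ⊓ I_w`, moved by `(s y₀)⁻¹`, normality of `U` placing `θ_w(d)` in `U`. [cite: NeukirchSchmidtWingberg2008, I §5 (1.5.6)–(1.5.7)]
[cite: Brown1982, III §5 (5.6)(b)] -/
theorem localization_shapiroLift_mem_unramifiedSubgroup_of_forall_conjH1_mem (z : subgroupH1 U M)
    (h : ∀ σ : absoluteGaloisGroup K, conjH1 U M σ z ∈ GreenbergVatsal2000.unramifiedKer U M w) :
    galoisCohomology.localization ((ofSMul M hM).coind U hU) (Sum.inr w) 1
        (shapiroLift (ofSMul M hM).toTopRep U hU hs hs1 z) ∈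
      DiscreteGaloisModule.unramifiedSubgroup (GaloisRep.toLocal w ((ofSMul M hM).coind U hU)) 1 := by
  obtain ⟨f, rfl⟩ := oneCocycleClass_surjective (subgroupRep (ofSMul M hM).toTopRep U) z
  refine (localization_mem_unramifiedSubgroup_iff_map_inertia_eq_zero hM U hU w _).2 ?_
  refine map_shapiroLift_eq_zero_of_reps (ofSMul M hM).toTopRep U hU
    ((absGaloisRestrict K (w.adicCompletion K)).comp
      (Literature.NumberTheory.GaloisRepresentations.subgroupIncl (absInertia (w.adicCompletion K))))
    hs hs1 f fun y₀ ↦ ?_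
  -- the conjugate by `s y₀` is unramified at `w`
  have hy := h (s y₀)
  change (conjMap (ofSMul M hM).toTopRep U (s y₀) 1).hom (oneCocycleClass _ f) ∈ GreenbergVatsal2000.unramifiedKer U M w at hy
  rw [conjMap_oneCocycleClass] at hy
  obtain ⟨m, hm⟩ := (mem_unramifiedKer_iff_exists (M := M) U w _).1 hy
  refine ⟨(s y₀)⁻¹ • m, fun d hd ↦ ?_⟩
  -- `x := θ d ∈ U ⊓ I_w ⊓ D_w`
  have hxI : absGaloisRestrict K (w.adicCompletion K) (d : absoluteGaloisGroup (w.adicCompletion K)) ∈ inertia w :=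
    Subgroup.mem_map_of_mem _ d.2
  have hxD : absGaloisRestrict K (w.adicCompletion K) (d : absoluteGaloisGroup (w.adicCompletion K)) ∈ decomp (K := K) w :=
    ⟨_, rfl⟩
  have hxU : absGaloisRestrict K (w.adicCompletion K) (d : absoluteGaloisGroup (w.adicCompletion K)) ∈ U := by
    have h' := Subgroup.Normal.conj_mem inferInstance _ hd (s y₀)
    rwa [show s y₀ * ((s y₀)⁻¹ * ((absGaloisRestrict K (w.adicCompletion K)).comp
        (Literature.NumberTheory.GaloisRepresentations.subgroupIncl (absInertia (w.adicCompletion K)))) d * s y₀) * (s y₀)⁻¹ =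
        ((absGaloisRestrict K (w.adicCompletion K)).comp
          (Literature.NumberTheory.GaloisRepresentations.subgroupIncl (absInertia (w.adicCompletion K)))) d by group] at h'
  set x : inertiaIn U w := ⟨⟨_, hxD⟩, (mem_inertiaIn_iff U w _).2 ⟨hxU, hxI⟩⟩ with hxdef
  have hmx := hm x
  -- `hmx : (s y₀) • f (subgroupConj U (s y₀) (inertiaInToH U w x)) = x • m - m`
  have hconj : subgroupConj U (s y₀) (inertiaInToH U w x) =
      ⟨(s y₀)⁻¹ * ((absGaloisRestrict K (w.adicCompletion K)).comp
        (Literature.NumberTheory.GaloisRepresentations.subgroupIncl (absInertia (w.adicCompletion K)))) d * s y₀, hd⟩ :=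
    Subtype.ext (by rw [subgroupConj_apply_coe]; rfl)
  rw [contOneCocycles.pullback_apply, hconj] at hmx
  change (s y₀) • f.1 _ = absGaloisRestrict K (w.adicCompletion K) (d : absoluteGaloisGroup (w.adicCompletion K)) • m - m at hmx
  have e : f.1 ⟨(s y₀)⁻¹ * ((absGaloisRestrict K (w.adicCompletion K)).comp
        (Literature.NumberTheory.GaloisRepresentations.subgroupIncl (absInertia (w.adicCompletion K)))) d * s y₀, hd⟩ =
      (s y₀)⁻¹ • (absGaloisRestrict K (w.adicCompletion K) (d : absoluteGaloisGroup (w.adicCompletion K)) • m - m) := by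
    rw [← hmx, smul_smul, inv_mul_cancel, one_smul]
  rw [e, smul_sub, smul_smul]
  change _ = ((s y₀)⁻¹ * absGaloisRestrict K (w.adicCompletion K) (d : absoluteGaloisGroup (w.adicCompletion K)) * s y₀) •
    ((s y₀)⁻¹ • m) - (s y₀)⁻¹ • m
  rw [smul_smul]
  congr 2
  group

/-- **THE UNRAMIFIED READING OF THE SHAPIRO LIFT (both directions).** For `z ∈ H¹(U, M)`: the localisation at `w` of its Shapiro lift
`Sh z ∈ H¹(K, Maps(Γ_K ⧸ U, M))` lies in `H¹_ur(K_w, Maps(Γ_K ⧸ U, M))` iff every conjugate `conjH1 U M σ z` (`σ ∈ Γ_K`, i.e. at every place of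
`F = K̄^U` above `w`) lies in `unramifiedKer U M w`. [cite: NeukirchSchmidtWingberg2008, I §6 Prop. (1.6.4)–(1.6.5)] [cite: Brown1982, III §5 (5.6)(b)]
[cite: GreenbergVatsal2000, §2 p. 17] -/
theorem localization_shapiroLift_mem_unramifiedSubgroup_iff (z : subgroupH1 U M) :
    galoisCohomology.localization ((ofSMul M hM).coind U hU) (Sum.inr w) 1
        (shapiroLift (ofSMul M hM).toTopRep U hU hs hs1 z) ∈
      DiscreteGaloisModule.unramifiedSubgroup (GaloisRep.toLocal w ((ofSMul M hM).coind U hU)) 1 ↔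
    ∀ σ : absoluteGaloisGroup K, conjH1 U M σ z ∈ GreenbergVatsal2000.unramifiedKer U M w :=
  ⟨conjH1_mem_unramifiedKer_of_localization_shapiroLift_mem hM U hU hs hs1 w z,
    localization_shapiroLift_mem_unramifiedSubgroup_of_forall_conjH1_mem hM U hU hs hs1 w z⟩

end Summit.BirchSwinnertonDyer.BirchSwinnertonDyer.Theorems.PrintCf2.LayerShapiro

end
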